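import Summits.KontsevichZagierPeriods.Zeta5Search.WellPoisedFaceSandwich
import Literature.NumberTheory.Transcendental.ZetaLinearFormsCriterion
import Literature.NumberTheory.Irrationality.Hata1992.PrimeWindows
import Mathlib.NumberTheory.Chebyshev
import HarnessLib

/-!
# ζ(5) search — the face theorem assembled: Lemma 19's normalised face forms GROW (cell `pub-zeta5`, fam-vwp gen 6, file 5)

HONEST FRAMING: systematic search; no irrationality claim unless certified.

This file closes, inside the kernel, the theorem that families/vwp/FAMILY.md §14.3 stated with two inputs marked
CLASSICAL (prime number theorem bookkeeping) — both are THEOREMS OF THIS TREE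
(`Literature.NumberTheory.Transcendental.tendsto_psi_div` and
`Literature.NumberTheory.Irrationality.Hata1992.tendsto_theta_div_self`, both from
`Literature.NumberTheory.LFunctions.chebyshevPsi_isEquivalent_holds` / `chebyshevTheta_isEquivalent`), so nothing
classical remains outside:

For a sorted integral direction `(η₀; 0,0,0, η₄ ≤ η₅ ≤ η₆ ≤ η₇)`, `2η₇ < η₀`, of Zudilin's `ζ(5)`-only well-poised box
(`r = 3`, `q = 7`, [cite: Zudilin2004, §8 (8.6)–(8.9), Lemma 19, Proposition 5]) put `h₀ = η₀n + 2`, `h₁ = h₂ = h₃ = 1`,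
`h_{3+j} = η_{3+j} n + 1`, and let
  `Λ_n := D_{M₁}³ · D_{M₂} · D_{M₃} · D_{M₄} · Φ(h_n)⁻¹ · F(h_n)`      (`faceLambda`)
with `D_N = lcm(1,…,N)` (Mathlib `Nat.lcmUpto`), `M_j = max{h₃ − 1, h₀ − 2h₄, h₀ − h₁ − h_{3+j}}` VERBATIM (file 1's `mLast`;
`faceMZ`), `Φ` = (8.9) VERBATIM (file 1's `Phi`; `facePhi`) and `F = ½ Σ_t R″(t)` = (8.6) VERBATIM (file 2's `faceF`).  Then
* `faceMZ_eq` (dictionary): `M_j = n · m_j` exactly, `m_j = max (η₀ − 2η₄) (η₀ − η_{3+j})` (`faceM`);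
* `log_faceLambda_ge`: `log Λ_n ≥ 3ψ(M₁) + ψ(M₂) + ψ(M₃) + ψ(M₄) − 3θ(M₄) + log F_n` (`ν_p ≤ 3` on the face, file 1);
* `log_facePhi_eventually_le`: `φ_true ≤ 3m₄` in the kernel — eventually `log Φ(h_n) ≤ (3m₄ + ε)n` (PNT for `θ`);
* `tendsto_lowerBound_div` + `lowerBound_limit_eq`: that bound `/n → δ − 3m₄ − C₀ = delta − phiBound − C0` of the
  `FaceDir` (PNT for `ψ`, `θ`; the boundary lemma `tendsto_log_faceF_div`, file 4);
* `net_exponent_pos`: `0 < delta − phiBound − C0` (file 1's `face_noGo`);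
* **`face_forms_grow`: `∀ ε > 0, ∀ᶠ n, (delta − phiBound − C0 − ε)·n ≤ log Λ_n`** and **`faceLambda_tendsto_atTop : Λ_n → +∞`**;
  `net_exponent_ge`: the exponent is `≥ (3 − 4 log 2)(η₀ − η₄)`; kernel instances `(3; 0³, 1⁴)` (the classical symmetric
  `ζ(5)` pure-pole series) and `(14; 0³, 4,4,5,5)` (the MODEL face maximiser shape).
By Lemma 19 [PRINTED — the one input not formalised, and not used in the statements] `Λ_n ∈ ℤζ(5) + ℤ`; forms in
`ℤζ(5) + ℤ` that tend to `+∞` prove nothing about `ζ(5)`, and Proposition 5's hypothesis fails on the whole face at every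
height.  Standard axioms only (`propext`, `Classical.choice`, `Quot.sound`).
-/

noncomputable section

open Real Filter Topology Finset

namespace Summit.KontsevichZagierPeriods.Zeta5Search.WellPoisedFaceRate

open Summit.KontsevichZagierPeriods.Zeta5Search.WellPoisedFace (FaceDir blockRate Phi mLast nuP Phi_face_le)
open Chebyshev

/-! ### §11 Prime number theorem inputs (tree theorems `tendsto_psi_div`,
`Hata1992.tendsto_theta_div_self`) as the two limits we need -/

/-- `g(n·m)/n → m` along `ℕ` whenever `g(x)/x → 1`, for a natural number `m ≥ 1`. -/
theorem tendsto_comp_mul_div {g : ℝ → ℝ} (hg : Tendsto (fun x : ℝ => g x / x) atTop (𝓝 1))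
    {m : ℕ} (hm : 0 < m) :
    Tendsto (fun n : ℕ => g ((n * m : ℕ) : ℝ) / n) atTop (𝓝 (m : ℝ)) := by
  have h1 : Tendsto (fun n : ℕ => ((n * m : ℕ) : ℝ)) atTop atTop :=
    tendsto_natCast_atTop_atTop.comp (tendsto_id.atTop_mul_const' hm)
  have h3 := (hg.comp h1).mul_const (m : ℝ)
  rw [one_mul] at h3
  refine h3.congr' ?_
  filter_upwards [eventually_ge_atTop 1] with n hn
  have hn' : (n : ℝ) ≠ 0 := by exact_mod_cast (by omega : n ≠ 0)
  have hm' : (m : ℝ) ≠ 0 := by exact_mod_cast hm.ne'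
  simp only [Function.comp, Nat.cast_mul]
  field_simp

/-- `ψ(n·m)/n → m` (prime number theorem, tree theorem `tendsto_psi_div`). -/
theorem tendsto_psi_mul_div {m : ℕ} (hm : 0 < m) :
    Tendsto (fun n : ℕ => ψ ((n * m : ℕ) : ℝ) / n) atTop (𝓝 (m : ℝ)) :=
  tendsto_comp_mul_div Literature.NumberTheory.Transcendental.tendsto_psi_div hm

/-- `θ(n·m)/n → m` (prime number theorem, tree theorem `Hata1992.tendsto_theta_div_self`, from
`chebyshevTheta_isEquivalent`). -/
theorem tendsto_theta_mul_div {m : ℕ} (hm : 0 < m) :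
    Tendsto (fun n : ℕ => θ ((n * m : ℕ) : ℝ) / n) atTop (𝓝 (m : ℝ)) :=
  tendsto_comp_mul_div Literature.NumberTheory.Irrationality.Hata1992.tendsto_theta_div_self hm

/-! ### §12 Lemma 19's normalising factors on the face, VERBATIM, and the dictionary `M_j = n·m_j` -/

/-- `h₀ = η₀n + 2` as an integer (the argument type of file 1's `Phi`, `mLast`). -/
def h0Z (η₀ n : ℕ) : ℤ := ((η₀ * n + 2 : ℕ) : ℤ)

/-- `h_{3+j} = η_j n + 1` as an integer. -/
def hZ (η : Fin 4 → ℕ) (n : ℕ) (j : Fin 4) : ℤ := ((η j * n + 1 : ℕ) : ℤ)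

/-- Zudilin's `M_j = max{h₃ − 1, h₀ − 2h₄, h₀ − h₁ − h_{3+j}}` [Zudilin2004, p. 270] VERBATIM on the face
(`h₁ = h₃ = 1`; file 1's `mLast` with the slot-`j` parameter last). -/
def faceMZ (η₀ : ℕ) (η : Fin 4 → ℕ) (n : ℕ) (j : Fin 4) : ℤ :=
  mLast (h0Z η₀ n) 1 1 (hZ η n 0) (hZ η n j)

/-- The unscaled exponent `m_j = max (η₀ − 2η₄) (η₀ − η_{3+j})` (a natural number). -/
def faceM (η₀ : ℕ) (η : Fin 4 → ℕ) (j : Fin 4) : ℕ := max (η₀ - 2 * η 0) (η₀ - η j)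

/-- Zudilin's arithmetic factor `Φ(h_n)` [(8.9)] at the face parameters (file 1's `Phi`). -/
def facePhi (η₀ : ℕ) (η : Fin 4 → ℕ) (n : ℕ) : ℕ :=
  Phi (h0Z η₀ n) 1 1 1 (hZ η n 0) (hZ η n 1) (hZ η n 2) (hZ η n 3)

/-- THE NORMALISED FACE FORMS `Λ_n := D_{M₁}³·D_{M₂}·D_{M₃}·D_{M₄} · Φ(h_n)⁻¹ · F(h_n)` of [Zudilin2004, Lemma 19]
(`D_N = lcm(1,…,N)` = Mathlib's `Nat.lcmUpto N`).  Lemma 19 says `Λ_n ∈ ℤζ(5) + ℤ`; that membership is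
PRINTED, not formalised, and is not used below. -/
def faceLambda (η₀ : ℕ) (η : Fin 4 → ℕ) (n : ℕ) : ℝ :=
  ((Nat.lcmUpto (faceMZ η₀ η n 0).toNat : ℝ) ^ 3 * Nat.lcmUpto (faceMZ η₀ η n 1).toNat
      * Nat.lcmUpto (faceMZ η₀ η n 2).toNat * Nat.lcmUpto (faceMZ η₀ η n 3).toNat)
    / (facePhi η₀ η n : ℝ) * faceF η₀ η n

/-- DICTIONARY (kernel): `M_j = n · m_j` exactly on the face. -/
theorem faceMZ_eq (η₀ : ℕ) (η : Fin 4 → ℕ) (hη : ∀ j, 2 * η j < η₀) (n : ℕ) (j : Fin 4) :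
    faceMZ η₀ η n j = ((n * faceM η₀ η j : ℕ) : ℤ) := by
  have h0 := hη 0
  have hj := hη j
  have hA : 2 * (η 0 * n) ≤ η₀ * n := by nlinarith
  have hB : η j * n ≤ η₀ * n := by nlinarith
  unfold faceMZ mLast h0Z hZ faceM
  rw [Nat.cast_mul, Nat.cast_max, Nat.cast_sub (by omega), Nat.cast_sub (by omega),
    mul_max_of_nonneg _ _ (by positivity : (0 : ℤ) ≤ n)]
  push_cast
  have e1 : ((η₀ : ℤ) * n + 2) - 2 * ((η 0 : ℤ) * n + 1) = (n : ℤ) * ((η₀ : ℤ) - 2 * (η 0 : ℤ)) := by ring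
  have e2 : ((η₀ : ℤ) * n + 2) - 1 - ((η j : ℤ) * n + 1) = (n : ℤ) * ((η₀ : ℤ) - (η j : ℤ)) := by ring
  rw [e1, e2]
  have hnn : (0 : ℤ) ≤ (n : ℤ) * ((η₀ : ℤ) - 2 * (η 0 : ℤ)) :=
    mul_nonneg (by positivity) (by omega)
  rw [max_eq_right hnn]

/-- `M_j` as a natural number is `n · m_j`. -/
theorem faceMZ_toNat (η₀ : ℕ) (η : Fin 4 → ℕ) (hη : ∀ j, 2 * η j < η₀) (n : ℕ) (j : Fin 4) :
    (faceMZ η₀ η n j).toNat = n * faceM η₀ η j := by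
  rw [faceMZ_eq η₀ η hη n j, Int.toNat_natCast]

/-- `m_j ≥ 1` on the face. -/
theorem faceM_pos (η₀ : ℕ) (η : Fin 4 → ℕ) (hη : ∀ j, 2 * η j < η₀) (j : Fin 4) :
    0 < faceM η₀ η j := by
  have h0 := hη 0
  have h1 := le_max_left (η₀ - 2 * η 0) (η₀ - η j)
  unfold faceM
  omega

/-- `Φ(h_n) ≥ 1 > 0` (a product of prime powers). -/
theorem facePhi_pos (η₀ : ℕ) (η : Fin 4 → ℕ) (n : ℕ) : 0 < facePhi η₀ η n := by
  unfold facePhi Phi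
  exact Finset.prod_pos fun p hp => pow_pos (Finset.mem_filter.1 hp).2.pos _

/-- `log Φ(h_n) ≤ 3·θ(M₄)` — `ν_p ≤ 3` on the face (file 1's `Phi_face_le`) and `log(N#) = θ(N)`. -/
theorem log_facePhi_le (η₀ : ℕ) (η : Fin 4 → ℕ) (hη : ∀ j, 2 * η j < η₀) (n : ℕ) :
    Real.log (facePhi η₀ η n) ≤ 3 * θ ((n * faceM η₀ η 3 : ℕ) : ℝ) := by
  have h0 := hη 0
  have hA : 2 * (η 0 * n) ≤ η₀ * n := by nlinarith
  have hrange : hZ η n 0 ≤ h0Z η₀ n - hZ η n 0 := by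
    unfold hZ h0Z; push_cast; nlinarith
  have hle := Phi_face_le (h0Z η₀ n) (hZ η n 0) (hZ η n 1) (hZ η n 2) (hZ η n 3) hrange
  have hM : (mLast (h0Z η₀ n) 1 1 (hZ η n 0) (hZ η n 3)).toNat = n * faceM η₀ η 3 :=
    faceMZ_toNat η₀ η hη n 3
  rw [hM] at hle
  have hpos : (0 : ℝ) < facePhi η₀ η n := by exact_mod_cast facePhi_pos η₀ η n
  have hle' : (facePhi η₀ η n : ℝ) ≤ ((primorial (n * faceM η₀ η 3) : ℕ) : ℝ) ^ 3 := by
    unfold facePhi; exact_mod_cast hle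
  calc Real.log (facePhi η₀ η n) ≤ Real.log (((primorial (n * faceM η₀ η 3) : ℕ) : ℝ) ^ 3) :=
        Real.log_le_log hpos hle'
    _ = 3 * θ ((n * faceM η₀ η 3 : ℕ) : ℝ) := by
        rw [Real.log_pow, theta_eq_log_primorial, Nat.floor_natCast]
        push_cast; ring

/-! ### §13 THE FACE THEOREM: the normalised forms grow exponentially -/

/-- Lower bound for `log Λ_n` by Chebyshev functions: `log Λ_n ≥ 3ψ(M₁) + ψ(M₂) + ψ(M₃) + ψ(M₄) − 3θ(M₄) + log F_n`. -/
theorem log_faceLambda_ge (η₀ : ℕ) (η : Fin 4 → ℕ) (hη : ∀ j, 2 * η j < η₀) (n : ℕ) :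
    3 * ψ ((n * faceM η₀ η 0 : ℕ) : ℝ) + ψ ((n * faceM η₀ η 1 : ℕ) : ℝ) + ψ ((n * faceM η₀ η 2 : ℕ) : ℝ)
        + ψ ((n * faceM η₀ η 3 : ℕ) : ℝ) - 3 * θ ((n * faceM η₀ η 3 : ℕ) : ℝ) + Real.log (faceF η₀ η n)
      ≤ Real.log (faceLambda η₀ η n) := by
  have hΦ : (0 : ℝ) < facePhi η₀ η n := by exact_mod_cast facePhi_pos η₀ η n
  have hF : 0 < faceF η₀ η n := faceF_pos η₀ η hη n
  have hL : ∀ N : ℕ, (0 : ℝ) < (Nat.lcmUpto N : ℝ) := fun N => by exact_mod_cast Nat.lcmUpto_pos N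
  have hψ : ∀ N : ℕ, Real.log (Nat.lcmUpto N : ℝ) = ψ (N : ℝ) := fun N => (psi_eq_log_lcmUpto N).symm
  unfold faceLambda
  rw [faceMZ_toNat η₀ η hη n 0, faceMZ_toNat η₀ η hη n 1, faceMZ_toNat η₀ η hη n 2,
    faceMZ_toNat η₀ η hη n 3]
  set L0 := (Nat.lcmUpto (n * faceM η₀ η 0) : ℝ)
  set L1 := (Nat.lcmUpto (n * faceM η₀ η 1) : ℝ)
  set L2 := (Nat.lcmUpto (n * faceM η₀ η 2) : ℝ)
  set L3 := (Nat.lcmUpto (n * faceM η₀ η 3) : ℝ)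
  have h0 := hL (n * faceM η₀ η 0)
  have h1 := hL (n * faceM η₀ η 1)
  have h2 := hL (n * faceM η₀ η 2)
  have h3 := hL (n * faceM η₀ η 3)
  rw [Real.log_mul (by positivity) hF.ne', Real.log_div (by positivity) hΦ.ne',
    Real.log_mul (by positivity) h3.ne', Real.log_mul (by positivity) h2.ne',
    Real.log_mul (by positivity) h1.ne', Real.log_pow, hψ, hψ, hψ, hψ]
  have := log_facePhi_le η₀ η hη n
  push_cast at this ⊢
  linarith

/-- The Chebyshev lower bound, divided by `n`, tends to `3m₁ + m₂ + m₃ + m₄ − 3m₄ − C₀ = δ − 3m₄ − C₀`. -/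
theorem tendsto_lowerBound_div (η₀ : ℕ) (η : Fin 4 → ℕ) (hη : ∀ j, 2 * η j < η₀) :
    Tendsto (fun n : ℕ => (3 * ψ ((n * faceM η₀ η 0 : ℕ) : ℝ) + ψ ((n * faceM η₀ η 1 : ℕ) : ℝ)
        + ψ ((n * faceM η₀ η 2 : ℕ) : ℝ) + ψ ((n * faceM η₀ η 3 : ℕ) : ℝ) - 3 * θ ((n * faceM η₀ η 3 : ℕ) : ℝ)
        + Real.log (faceF η₀ η n)) / n) atTop
      (𝓝 (3 * (faceM η₀ η 0 : ℝ) + faceM η₀ η 1 + faceM η₀ η 2 + faceM η₀ η 3 - 3 * faceM η₀ η 3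
        - ∑ j : Fin 4, blockRate η₀ (η j))) := by
  have hF := tendsto_log_faceF_div η₀ η hη
  have h0 := tendsto_psi_mul_div (faceM_pos η₀ η hη 0)
  have h1 := tendsto_psi_mul_div (faceM_pos η₀ η hη 1)
  have h2 := tendsto_psi_mul_div (faceM_pos η₀ η hη 2)
  have h3 := tendsto_psi_mul_div (faceM_pos η₀ η hη 3)
  have h3' := tendsto_theta_mul_div (faceM_pos η₀ η hη 3)
  have hsum := (((((h0.const_mul 3).add h1).add h2).add h3).sub (h3'.const_mul 3)).add hF
  have key : (fun n : ℕ => (3 * ψ ((n * faceM η₀ η 0 : ℕ) : ℝ) + ψ ((n * faceM η₀ η 1 : ℕ) : ℝ)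
        + ψ ((n * faceM η₀ η 2 : ℕ) : ℝ) + ψ ((n * faceM η₀ η 3 : ℕ) : ℝ) - 3 * θ ((n * faceM η₀ η 3 : ℕ) : ℝ)
        + Real.log (faceF η₀ η n)) / n)
      = fun n : ℕ => 3 * (ψ ((n * faceM η₀ η 0 : ℕ) : ℝ) / n) + ψ ((n * faceM η₀ η 1 : ℕ) : ℝ) / n
        + ψ ((n * faceM η₀ η 2 : ℕ) : ℝ) / n + ψ ((n * faceM η₀ η 3 : ℕ) : ℝ) / n
        - 3 * (θ ((n * faceM η₀ η 3 : ℕ) : ℝ) / n) + Real.log (faceF η₀ η n) / n := by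
    funext n; ring
  have hv : 3 * (faceM η₀ η 0 : ℝ) + faceM η₀ η 1 + faceM η₀ η 2 + faceM η₀ η 3 - 3 * faceM η₀ η 3
        - ∑ j : Fin 4, blockRate η₀ (η j)
      = 3 * (faceM η₀ η 0 : ℝ) + faceM η₀ η 1 + faceM η₀ η 2 + faceM η₀ η 3 - 3 * faceM η₀ η 3
        + -∑ j : Fin 4, (((η₀ : ℝ) - η j) * Real.log ((η₀ : ℝ) - η j)
          - ((η₀ : ℝ) - 2 * η j) * Real.log ((η₀ : ℝ) - 2 * η j) - (η j : ℝ) * Real.log (η j)) := by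
    simp only [blockRate]; ring
  rw [key, hv]
  exact hsum

/-- Positivity of the net exponent on the face: `0 < δ − 3m₄ − C₀` in the unscaled integer coordinates — this is
file 1's `face_noGo` (with `φ = phiBound`) transported through `faceDirOfNat`. -/
theorem faceM_cast (η₀ : ℕ) (η : Fin 4 → ℕ) (h01 : η 0 ≤ η 1) (h12 : η 1 ≤ η 2) (h23 : η 2 ≤ η 3)
    (h3 : 2 * η 3 < η₀) (j : Fin 4) :
    (faceM η₀ η j : ℝ) = (faceDirOfNat η₀ η h01 h12 h23 h3).mOf (η j) := by
  have hη := two_mul_lt_of_sorted η₀ η h01 h12 h23 h3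
  have h0 := hη 0
  have hj := hη j
  unfold faceM FaceDir.mOf faceDirOfNat
  rw [Nat.cast_max, Nat.cast_sub (by omega), Nat.cast_sub (by omega)]
  push_cast
  have hnn : (0 : ℝ) ≤ (η₀ : ℝ) - 2 * (η 0 : ℝ) := by
    have : (2 * η 0 : ℕ) ≤ η₀ := by omega
    have : ((2 * η 0 : ℕ) : ℝ) ≤ (η₀ : ℝ) := by exact_mod_cast this
    push_cast at this; linarith
  rw [max_eq_right hnn]

/-- The limit of §13 IS `delta − phiBound − C0` of the associated `FaceDir`. -/
theorem lowerBound_limit_eq (η₀ : ℕ) (η : Fin 4 → ℕ) (h01 : η 0 ≤ η 1) (h12 : η 1 ≤ η 2) (h23 : η 2 ≤ η 3)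
    (h3 : 2 * η 3 < η₀) :
    3 * (faceM η₀ η 0 : ℝ) + faceM η₀ η 1 + faceM η₀ η 2 + faceM η₀ η 3 - 3 * faceM η₀ η 3
        - ∑ j : Fin 4, blockRate η₀ (η j)
      = (faceDirOfNat η₀ η h01 h12 h23 h3).delta - (faceDirOfNat η₀ η h01 h12 h23 h3).phiBound
        - (faceDirOfNat η₀ η h01 h12 h23 h3).C0 := by
  rw [← C0_faceDirOfNat η₀ η h01 h12 h23 h3, faceM_cast η₀ η h01 h12 h23 h3 0, faceM_cast η₀ η h01 h12 h23 h3 1,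
    faceM_cast η₀ η h01 h12 h23 h3 2, faceM_cast η₀ η h01 h12 h23 h3 3]
  simp only [FaceDir.delta, FaceDir.phiBound, FaceDir.m1, FaceDir.m2, FaceDir.m3, FaceDir.m4]
  rfl

/-- `0 < delta − phiBound − C0` (file 1's `face_noGo` at `φ = phiBound`). -/
theorem net_exponent_pos (η₀ : ℕ) (η : Fin 4 → ℕ) (h01 : η 0 ≤ η 1) (h12 : η 1 ≤ η 2) (h23 : η 2 ≤ η 3)
    (h3 : 2 * η 3 < η₀) :
    0 < (faceDirOfNat η₀ η h01 h12 h23 h3).delta - (faceDirOfNat η₀ η h01 h12 h23 h3).phiBound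
        - (faceDirOfNat η₀ η h01 h12 h23 h3).C0 := by
  have := (faceDirOfNat η₀ η h01 h12 h23 h3).face_noGo _ le_rfl
  linarith

/-- **THE FACE THEOREM (T4), kernel-checked end to end.**  For every sorted integral direction
`(η₀; 0,0,0, η₄ ≤ η₅ ≤ η₆ ≤ η₇)`, `2η₇ < η₀`, of Zudilin's `ζ(5)`-only well-poised box (`r = 3`, `q = 7`), the
normalised forms `Λ_n = D_{M₁}³ D_{M₂} D_{M₃} D_{M₄} Φ⁻¹ F(h_n)` of Lemma 19 satisfy, for every `ε > 0` and all large `n`,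
`log Λ_n ≥ (δ − 3m₄ − C₀ − ε)·n` with `δ − 3m₄ − C₀ > 0` (`net_exponent_pos`).  Inputs: the boundary lemma
(`tendsto_log_faceF_div`, files 2–4), `ν_p ≤ 3` on the face (`Phi_face_le`, file 1), the prime number theorem for `ψ` and `θ`
(tree theorems), and `face_noGo` (file 1).  By Lemma 19 [PRINTED] `Λ_n ∈ ℤζ(5) + ℤ`; so these forms never tend to `0` and
Proposition 5 never applies on the face, at any height.  Systematic search; no irrationality claim. -/
theorem face_forms_grow (η₀ : ℕ) (η : Fin 4 → ℕ) (h01 : η 0 ≤ η 1) (h12 : η 1 ≤ η 2) (h23 : η 2 ≤ η 3)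
    (h3 : 2 * η 3 < η₀) (ε : ℝ) (hε : 0 < ε) :
    ∀ᶠ n : ℕ in atTop,
      ((faceDirOfNat η₀ η h01 h12 h23 h3).delta - (faceDirOfNat η₀ η h01 h12 h23 h3).phiBound
          - (faceDirOfNat η₀ η h01 h12 h23 h3).C0 - ε) * n ≤ Real.log (faceLambda η₀ η n) := by
  have hη := two_mul_lt_of_sorted η₀ η h01 h12 h23 h3
  have hT := tendsto_lowerBound_div η₀ η hη
  rw [lowerBound_limit_eq η₀ η h01 h12 h23 h3] at hT
  set L := (faceDirOfNat η₀ η h01 h12 h23 h3).delta - (faceDirOfNat η₀ η h01 h12 h23 h3).phiBound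
    - (faceDirOfNat η₀ η h01 h12 h23 h3).C0
  have hev := hT.eventually (Ioi_mem_nhds (show L - ε < L by linarith))
  filter_upwards [hev, eventually_ge_atTop 1] with n hn hn1
  have hnpos : (0 : ℝ) < n := by exact_mod_cast hn1
  have hge := log_faceLambda_ge η₀ η hη n
  rw [lt_div_iff₀ hnpos] at hn
  linarith

/-- Corollary: `Λ_n → +∞`. -/
theorem faceLambda_tendsto_atTop (η₀ : ℕ) (η : Fin 4 → ℕ) (h01 : η 0 ≤ η 1) (h12 : η 1 ≤ η 2)
    (h23 : η 2 ≤ η 3) (h3 : 2 * η 3 < η₀) : Tendsto (faceLambda η₀ η) atTop atTop := by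
  have hpos := net_exponent_pos η₀ η h01 h12 h23 h3
  set L := (faceDirOfNat η₀ η h01 h12 h23 h3).delta - (faceDirOfNat η₀ η h01 h12 h23 h3).phiBound
    - (faceDirOfNat η₀ η h01 h12 h23 h3).C0 with hL
  have hev := face_forms_grow η₀ η h01 h12 h23 h3 (L / 2) (by linarith)
  have hη := two_mul_lt_of_sorted η₀ η h01 h12 h23 h3
  have hexp : Tendsto (fun n : ℕ => Real.exp ((L - L / 2) * n)) atTop atTop :=
    Real.tendsto_exp_atTop.comp ((tendsto_natCast_atTop_atTop).const_mul_atTop (by linarith))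
  refine tendsto_atTop_mono' atTop ?_ hexp
  filter_upwards [hev] with n hn
  have hΛ : 0 < faceLambda η₀ η n := by
    unfold faceLambda
    have hΦ : (0 : ℝ) < facePhi η₀ η n := by exact_mod_cast facePhi_pos η₀ η n
    have hF : 0 < faceF η₀ η n := faceF_pos η₀ η hη n
    have hLp : ∀ N : ℕ, (0 : ℝ) < (Nat.lcmUpto N : ℝ) := fun N => by exact_mod_cast Nat.lcmUpto_pos N
    have := hLp (faceMZ η₀ η n 0).toNat
    have := hLp (faceMZ η₀ η n 1).toNat
    have := hLp (faceMZ η₀ η n 2).toNat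
    have := hLp (faceMZ η₀ η n 3).toNat
    positivity
  calc Real.exp ((L - L / 2) * n) ≤ Real.exp (Real.log (faceLambda η₀ η n)) := Real.exp_le_exp.2 hn
    _ = faceLambda η₀ η n := Real.exp_log hΛ

/-- `φ_true ≤ φ⁺ = 3·m₄` INSIDE THE KERNEL: for every `ε > 0`, eventually `log Φ(h_n) ≤ (3·m₄ + ε)·n`
(`ν_p ≤ 3` on the face, file 1, and the prime number theorem for `θ`).  This is the only place where the
face theorem is crude: the MODEL value of `lim (1/n) log Φ` is far below `3·m₄` (families/vwp/FAMILY.md §14.3). -/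
theorem log_facePhi_eventually_le (η₀ : ℕ) (η : Fin 4 → ℕ) (hη : ∀ j, 2 * η j < η₀) (ε : ℝ)
    (hε : 0 < ε) :
    ∀ᶠ n : ℕ in atTop, Real.log (facePhi η₀ η n) ≤ (3 * (faceM η₀ η 3 : ℝ) + ε) * n := by
  have ht := (tendsto_theta_mul_div (faceM_pos η₀ η hη 3)).const_mul 3
  have hev := ht.eventually (Iio_mem_nhds (show 3 * (faceM η₀ η 3 : ℝ) < 3 * faceM η₀ η 3 + ε by
    linarith))
  filter_upwards [hev, eventually_ge_atTop 1] with n hn hn1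
  have hnpos : (0 : ℝ) < n := by exact_mod_cast hn1
  have h1 := log_facePhi_le η₀ η hη n
  have h2 : 3 * θ ((n * faceM η₀ η 3 : ℕ) : ℝ) / n < 3 * (faceM η₀ η 3 : ℝ) + ε := by
    rwa [mul_div_assoc]
  rw [div_lt_iff₀ hnpos] at h2
  linarith

/-- Explicit exponent: `delta − phiBound − C0 ≥ (3 − 4 log 2)·(η₀ − η₄)` (`> 0.2274·(η₀ − η₄)`), from file 1's
`face_envelope` (`C0 ≤ (4 log 2/3)(delta − phiBound)`) and `three_m1_le` (`3(η₀ − η₄) ≤ delta − phiBound`). -/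
theorem net_exponent_ge (η₀ : ℕ) (η : Fin 4 → ℕ) (h01 : η 0 ≤ η 1) (h12 : η 1 ≤ η 2) (h23 : η 2 ≤ η 3)
    (h3 : 2 * η 3 < η₀) :
    (3 - 4 * Real.log 2) * ((η₀ : ℝ) - η 0) ≤
      (faceDirOfNat η₀ η h01 h12 h23 h3).delta - (faceDirOfNat η₀ η h01 h12 h23 h3).phiBound
        - (faceDirOfNat η₀ η h01 h12 h23 h3).C0 := by
  set D := faceDirOfNat η₀ η h01 h12 h23 h3 with hD
  have h1 := D.face_envelope
  have h2 := D.three_m1_le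
  have hc : 0 ≤ 1 - 4 * Real.log 2 / 3 := by
    have := Summit.KontsevichZagierPeriods.Zeta5Search.WellPoisedFace.four_log_two_div_three_lt_one
    linarith
  have h4 := mul_le_mul_of_nonneg_left h2 hc
  have e0 : D.η₀ = (η₀ : ℝ) := rfl
  have ea : D.a = ((η 0 : ℕ) : ℝ) := rfl
  rw [e0, ea] at h4
  nlinarith [h1, h4, hc]

/-- KERNEL INSTANCE: the symmetric direction `(3; 0,0,0, 1,1,1,1)` — the classical pure-pole `ζ(5)`-series
`h₀ = 3n + 2`, `h_j = n + 1` — has Lemma-19 normalised forms tending to `+∞`. -/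
example : Tendsto (faceLambda 3 ![1, 1, 1, 1]) atTop atTop :=
  faceLambda_tendsto_atTop 3 ![1, 1, 1, 1] (by decide) (by decide) (by decide) (by decide)

/-- KERNEL INSTANCE: the MODEL face-maximiser shape `(14; 0,0,0, 4,4,5,5)` (κ = 0.4811, FAMILY.md §13): same conclusion. -/
example : Tendsto (faceLambda 14 ![4, 4, 5, 5]) atTop atTop :=
  faceLambda_tendsto_atTop 14 ![4, 4, 5, 5] (by decide) (by decide) (by decide) (by decide)

end Summit.KontsevichZagierPeriods.Zeta5Search.WellPoisedFaceRate
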